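import Mathlib
import Summits.ValiantsHypothesis.ValiantsHypothesis.Theorems.GrenetZeonPolySizeQPAlgebraJetTransport
import Summits.ValiantsHypothesis.ValiantsHypothesis.Theorems.GrenetZeonPolySizeQPAlgebraJetHessian
import Summits.ValiantsHypothesis.ValiantsHypothesis.Theorems.GrenetZeonPolySizeQPAlgebraLocalReduction
import HarnessLib

/-!
# Crux `GrenetZeon.PolySizeQPAlgebra` (stmt-ValiantsHypothesis-8064), line `vbp-slice-dealg` —
# the local Hessian bound for CURVILINEAR coefficient algebras, in coefficient-algebra currency

`…JetHessian` proves the jet bound `rank Hess(Σ_{j<r} λ_j [t^j] det M)(p) ≤ r·2m` when the lower jets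
and the form vanish at `p`, in JET currency (polynomial matrices over `ℂ[x_σ][t]`), and `…JetTransport`
turns a piece `λ(det_R A)` over a curvilinear algebra `R = ℂ[ε]/ε^r` (basis `1, e, …, e^{r-1}`, `e^r = 0`)
into such a jet form.  The type-independent input `LocalHessianBound` of `…LocalReduction` /
`…LocalReductionDim`, however, is stated in COEFFICIENT-ALGEBRA currency: the hypothesis at the point `p` is
`det A(p) = 0` computed in `R`.  This file supplies the missing dictionary entry:

* `exists_jet_matrix_of_basis_pow` — the transport of `…JetTransport` with the substitution identity kept for
  EVERY functional `ψ : R → ℂ` at once: `ψ(coeff_d det A) = Σ_{j<r} ψ(e^j) · coeff_d [t^j] det M`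
  (same construction; `exists_jet_form_of_basis_pow` only records it for the reading functional `λ`).
* `rank_hess0_transl_le_of_basis_pow` — **for a commutative `ℂ`-algebra `R` with basis `(1, e, …, e^{r-1})`,
  `e^r = 0`, every functional `λ`, every affine `n × n` matrix `A` over `R[x_σ]` with `F = λ(det A)`
  coefficientwise, and every point `p` with `det A(p) = 0` IN `R`: `rank Hess F(p) ≤ 2 · dim_ℂ R · n`.**
  (The jets `[t^j] det M` are the coordinates of `det A` along the basis, so `det A(p) = 0` in `R` says that
  ALL jets vanish at `p`; then `rank_hess0_transl_jet_le`.)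

So the input `LocalHessianBound` is a theorem, in the exact shape consumed by
`not_hasAlgDetRepr_perPoly_self_of_localHessianBound_dim`, for every curvilinear type and every `n`
(companion files: square-zero types `…SquareZeroResidue`, `𝔪³ = 0` types `…CubeZeroIntrinsic`).
HONEST FRAMING: bookkeeping / a rank theorem for a class of coefficient algebras; no stub of the line is
closed; VP ≠ VNP is not moved.

References: T. Mignon, N. Ressayre, IMRN 2004:79, §2 [MignonRessayre2004]; P. Hrubeš, A. Yehudayoff,
Theory of Computing 7 (2011), §2 [HrubesYehudayoff2011].
-/

noncomputable section

open MvPolynomial Matrix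
open Literature.Computability.AlgebraicComplexity

-- single-conjunct layout `Summits/ValiantsHypothesis/ValiantsHypothesis`: duplicated namespace by design
set_option linter.dupNamespace false

namespace Summit.ValiantsHypothesis.ValiantsHypothesis.Theorems.GrenetZeonPolySizeQPAlgebra

open Summit.ValiantsHypothesis.ValiantsHypothesis.Cruxes.TwoDimCoefficients.DimTwoCases
  (coeff_sum_monomial_support totalDegree_sum_monomial_support_le)

section Transport

universe v

variable {σ : Type v} {R : Type*} [CommRing R] [Algebra ℂ R]

/-- **Jet matrix of a curvilinear piece, all functionals at once.**  Let `R` be a commutative `ℂ`-algebra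
with a basis `b = (e^0, …, e^{r-1})` and `e^r = 0`, and `A` a square matrix over `R[x_σ]`.  There is a matrix
`M` over `ℂ[x_σ][t]` whose coefficient matrices are coordinate projections of `A` (degrees and homogeneity are
not enlarged) such that for EVERY `ℂ`-linear `ψ : R → ℂ` and every exponent `d`:
`ψ(coeff_d det A) = Σ_{j<r} ψ(e^j) · coeff_d ([t^j] det M)` — the substitution `t ↦ e` maps `M` to `A`.
(Construction of `exists_jet_form_of_basis_pow`, `…JetTransport`.) [cite: HrubesYehudayoff2011, §2] -/
theorem exists_jet_matrix_of_basis_pow {r m : ℕ} (e : R) (he : e ^ r = 0) (b : Module.Basis (Fin r) ℂ R)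
    (hb : ∀ j : Fin r, b j = e ^ (j : ℕ)) (A : Matrix (Fin m) (Fin m) (MvPolynomial σ R)) :
    ∃ M : Matrix (Fin m) (Fin m) (Polynomial (MvPolynomial σ ℂ)),
      (∀ i k a, ((M i k).coeff a).totalDegree ≤ (A i k).totalDegree) ∧
      (∀ i k a N, (A i k).IsHomogeneous N → ((M i k).coeff a).IsHomogeneous N) ∧
      ∀ (ψ : R →ₗ[ℂ] ℂ) (d : σ →₀ ℕ),
        ψ (coeff d A.det) = ∑ j ∈ Finset.range r, ψ (e ^ j) * coeff d (M.det.coeff j) := by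
  classical
  -- coordinate projections and the polynomial matrix (as in `exists_jet_form_of_basis_pow`)
  set π : Fin r → MvPolynomial σ R → MvPolynomial σ ℂ := fun j p =>
    ∑ d' ∈ p.support, monomial d' (b.coord j (p.coeff d')) with hπ
  set M : Matrix (Fin m) (Fin m) (Polynomial (MvPolynomial σ ℂ)) := Matrix.of fun i k =>
    ∑ j : Fin r, Polynomial.monomial (j : ℕ) (π j (A i k)) with hM
  have hMcoeff : ∀ i k a, (M i k).coeff a = if h : a < r then π ⟨a, h⟩ (A i k) else 0 := by
    intro i k a
    rw [hM, Matrix.of_apply, Polynomial.finsetSum_coeff]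
    simp only [Polynomial.coeff_monomial]
    split_ifs with h
    · rw [Finset.sum_eq_single ⟨a, h⟩ (fun j _ hj => if_neg fun h' => hj (Fin.ext h')) (by simp),
        if_pos rfl]
    · exact Finset.sum_eq_zero fun j _ => if_neg fun h' => h (by rw [← h']; exact j.2)
  -- the substitution `t ↦ e`
  set ι : MvPolynomial σ ℂ →+* MvPolynomial σ R := MvPolynomial.map (algebraMap ℂ R) with hι
  set Θ : Polynomial (MvPolynomial σ ℂ) →+* MvPolynomial σ R := Polynomial.eval₂RingHom ι (C e)
    with hΘ
  have hΘM : Θ.mapMatrix M = A := by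
    ext i k d
    rw [RingHom.mapMatrix_apply, Matrix.map_apply, hM, Matrix.of_apply, map_sum, coeff_sum]
    have hterm : ∀ j : Fin r, coeff d (Θ (Polynomial.monomial (j : ℕ) (π j (A i k)))) =
        (if d ∈ (A i k).support then b.coord j ((A i k).coeff d) else 0) • e ^ (j : ℕ) := by
      intro j
      rw [hΘ, Polynomial.coe_eval₂RingHom, Polynomial.eval₂_monomial, ← map_pow, mul_comm,
        coeff_C_mul, hι, coeff_map, hπ, coeff_sum_monomial_support, Algebra.smul_def, mul_comm]
    rw [Finset.sum_congr rfl fun j _ => hterm j]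
    by_cases hd : d ∈ (A i k).support
    · simp only [if_pos hd]
      conv_rhs => rw [← b.sum_repr (coeff d (A i k))]
      exact Finset.sum_congr rfl fun j _ => by rw [hb j, Module.Basis.coord_apply]
    · simp only [if_neg hd, zero_smul, Finset.sum_const_zero]
      exact (notMem_support_iff.1 hd).symm
  have hdet : A.det = Θ M.det := by
    rw [RingHom.map_det, hΘM]
  refine ⟨M, fun i k a => ?_, fun i k a N hN => ?_, fun ψ d => ?_⟩
  · rw [hMcoeff]
    split_ifs with h
    · exact totalDegree_sum_monomial_support_le _ _
    · rw [totalDegree_zero]; exact Nat.zero_le _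
  · rw [hMcoeff]
    split_ifs with h
    · exact isHomogeneous_sum_monomial_support _ hN
    · exact isHomogeneous_zero σ ℂ N
  · rw [hdet, hΘ, apply_coeff_eval₂_C_eq_sum e he ψ]

/-- **The jets are the coordinates.**  With `M` as in `exists_jet_matrix_of_basis_pow`, the `j`-th jet
`[t^j] det M` is, coefficientwise, the `e^j`-coordinate of `det A`. [folklore] -/
theorem coeff_jet_eq_coord_of_basis_pow {r m : ℕ} (e : R) (b : Module.Basis (Fin r) ℂ R)
    (hb : ∀ j : Fin r, b j = e ^ (j : ℕ)) (A : Matrix (Fin m) (Fin m) (MvPolynomial σ R))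
    (M : Matrix (Fin m) (Fin m) (Polynomial (MvPolynomial σ ℂ)))
    (hM : ∀ (ψ : R →ₗ[ℂ] ℂ) (d : σ →₀ ℕ),
      ψ (coeff d A.det) = ∑ j ∈ Finset.range r, ψ (e ^ j) * coeff d (M.det.coeff j))
    (j : Fin r) (d : σ →₀ ℕ) : coeff d (M.det.coeff j) = b.coord j (coeff d A.det) := by
  rw [hM (b.coord j) d, Finset.sum_eq_single (j : ℕ)]
  · rw [← hb j, Module.Basis.coord_apply, Module.Basis.repr_self, Finsupp.single_eq_same, one_mul]
  · intro i hi hij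
    have hir : i < r := Finset.mem_range.1 hi
    rw [← hb ⟨i, hir⟩, Module.Basis.coord_apply, Module.Basis.repr_self,
      Finsupp.single_eq_of_ne (fun h => hij (congrArg Fin.val h).symm), zero_mul]
  · intro hj
    exact absurd (Finset.mem_range.2 j.2) hj

/-- **`det A(p) = 0` in `R` ⟹ every jet vanishes at `p`.** [folklore] -/
theorem eval_jet_eq_zero_of_basis_pow {r m : ℕ} (e : R) (b : Module.Basis (Fin r) ℂ R)
    (hb : ∀ j : Fin r, b j = e ^ (j : ℕ)) (A : Matrix (Fin m) (Fin m) (MvPolynomial σ R))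
    (M : Matrix (Fin m) (Fin m) (Polynomial (MvPolynomial σ ℂ)))
    (hM : ∀ (ψ : R →ₗ[ℂ] ℂ) (d : σ →₀ ℕ),
      ψ (coeff d A.det) = ∑ j ∈ Finset.range r, ψ (e ^ j) * coeff d (M.det.coeff j))
    (p : σ → ℂ) (hp : eval (fun i => algebraMap ℂ R (p i)) A.det = 0) (j : Fin r) :
    eval p (M.det.coeff j) = 0 := by
  classical
  have h1 : M.det.coeff j = ∑ d ∈ A.det.support, monomial d (b.coord j (A.det.coeff d)) := by
    refine MvPolynomial.ext _ _ fun d => ?_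
    rw [coeff_sum_monomial_support, coeff_jet_eq_coord_of_basis_pow e b hb A M hM j d]
    split_ifs with hd
    · rfl
    · rw [notMem_support_iff.1 hd, map_zero]
  rw [h1, eval_sum_monomial_support_eq, hp, map_zero]

variable [Fintype σ]

/-- **`LocalHessianBound` for every CURVILINEAR coefficient algebra, every `n`, coefficient-algebra
currency.**  Let `R` be a commutative `ℂ`-algebra with a basis `(1, e, …, e^{r-1})` and `e^r = 0`
(`R ≅ ℂ[ε]/ε^r`), `λ : R → ℂ` linear, `A` an `n × n` matrix of affine entries over `R[x_σ]`, `F ∈ ℂ[x_σ]` with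
`λ(coeff_d det A) = coeff_d F`, and `p` a point with `det A(p) = 0` computed in `R`.  Then
`rank Hess F(p) ≤ 2 · dim_ℂ R · n`.  Proof: transport to the jet form `Σ_{j<r} λ(e^j) [t^j] det M`
(`exists_jet_matrix_of_basis_pow`); all jets vanish at `p` (`eval_jet_eq_zero_of_basis_pow`); the jet
Hessian bound `rank_hess0_transl_jet_le` gives `r · 2n`. [cite: MignonRessayre2004, §2] -/
theorem rank_hess0_transl_le_of_basis_pow {r n : ℕ} (e : R) (he : e ^ r = 0)
    (b : Module.Basis (Fin r) ℂ R) (hb : ∀ j : Fin r, b j = e ^ (j : ℕ)) (l : R →ₗ[ℂ] ℂ)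
    (A : Matrix (Fin n) (Fin n) (MvPolynomial σ R)) (F : MvPolynomial σ ℂ)
    (hA : ∀ a b, (A a b).totalDegree ≤ 1) (hF : ∀ d, l (coeff d A.det) = coeff d F) (p : σ → ℂ)
    (hp : eval (fun i => algebraMap ℂ R (p i)) A.det = 0) :
    (hess0 (transl p F)).rank ≤ 2 * Module.finrank ℂ R * n := by
  classical
  obtain ⟨M, hMdeg, -, hM⟩ := exists_jet_matrix_of_basis_pow e he b hb A
  -- `F` is the jet form read through `λ`
  have hFjet : F = ∑ j ∈ Finset.range r, C (l (e ^ j)) * M.det.coeff j := by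
    refine MvPolynomial.ext _ _ fun d => ?_
    rw [← hF d, hM l d, coeff_sum]
    exact Finset.sum_congr rfl fun j _ => by rw [coeff_C_mul]
  -- all jets vanish at `p`
  have hjet : ∀ j : Fin r, eval p (M.det.coeff j) = 0 :=
    eval_jet_eq_zero_of_basis_pow e b hb A M hM p hp
  have hvan : ∀ j, j + 2 ≤ r → eval p (M.det.coeff j) = 0 := fun j hj => hjet ⟨j, by omega⟩
  have hf : eval p (∑ j ∈ Finset.range r, C (l (e ^ j)) * M.det.coeff j) = 0 := by
    rw [map_sum]
    refine Finset.sum_eq_zero fun j hj => ?_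
    rw [map_mul, hjet ⟨j, Finset.mem_range.1 hj⟩, mul_zero]
  have hrank := rank_hess0_transl_jet_le r M (fun j => l (e ^ j))
    (fun i k a => (hMdeg i k a).trans (hA i k)) p hvan hf
  have hfin : Module.finrank ℂ R = r := by
    rw [Module.finrank_eq_card_basis b, Fintype.card_fin]
  rw [hFjet, hfin]
  calc (hess0 (transl p (∑ j ∈ Finset.range r, C (l (e ^ j)) * M.det.coeff j))).rank
      ≤ r * (2 * n) := hrank
    _ = 2 * r * n := by ring

end Transport

end Summit.ValiantsHypothesis.ValiantsHypothesis.Theorems.GrenetZeonPolySizeQPAlgebra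

end
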